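import Mathlib
import HarnessLib
import Summits.Ventures.LatticeQCDFlow.Exactness.NCMCGeneralSpaceDoeblinPowerEveryStart
import Summits.Ventures.LatticeQCDFlow.Exactness.NCMCGeneralSpaceTemperedErgodic

/-!
# The tempered-transitions lane converges from EVERY initial configuration, with a certified burn-in

HONEST FRAMING: exact (Metropolis-corrected) sampling algorithms for lattice gauge theory;
figures of merit are autocorrelation/cost numbers at stated couplings and volumes; no
continuum-physics claim.

Venture `LatticeQCDFlow` (cell pub-lqcd), topic `Exactness`; FANOUT row 13 (`eng-snf`, GEN-18).
NEW WORK of the cell, not a published result; no definition is introduced; nothing is cited as a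
fact.  GEN-17's `NCMCGeneralSpaceTemperedErgodic.lean` proved: ANY exact move `S` after a level
sampler `T` minorised by a non-zero finite measure `m` gives an ergodic chain, hence `latflow-snf`'s
`correction = tempered-transitions` lane (round trip `ttKernel ∘ₖ T`) is consistent from `π₀` — and,
by GEN-17's general transfer, from ALMOST every start.  But `S ∘ₖ T` is minorised in ONE step by
`S ∘ₘ m` (`NCMCGeneralSpaceSweepRestart.measure_le_comp`), so GEN-18's Liouville step
(`NCMCGeneralSpaceDoeblinPowerEveryStart`) removes the exceptional set: EVERY start, plus the
one-step Doeblin burn-in of `NCMCGeneralSpaceDoeblinPower`.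

## Content

* §1 `smul_normalised_bind_le_nHit_one` (the one-step minorisation in skeleton form,
  `m(Ω) • ((m(Ω))⁻¹ (S ∘ₘ m)) ≤ nHit (S ∘ₖ T) 1 z`), **`tendsto_sum_div_everyStart_chain_comp`** —
  `S`, `T` Markov, `π` invariant for `S ∘ₖ T`, `m ≤ T(z, ·)` for all `z` (`m` finite, `≠ 0`): for
  every measurable `φ ∈ L¹(π)` and EVERY `z`, `P_{δ_z}`-a.s. `(1/n) Σ_{i<n} φ(x_i) → ∫ φ dπ`;
  `tendsto_sum_div_anyLaw_chain_comp`; **`chain_timeAverage_bias_le_chain_comp`** — certified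
  burn-in `|E_{μ₀}[(1/n) Σ_{t<n} g(X_t)] − π g| ≤ 1/(m(Ω) n)` for `[0,1]`-valued `g`, any initial law.
* §2 **`CrooksPair.tendsto_sum_div_temperedChain_everyStart`** — THE TEMPERED-TRANSITIONS LANE FROM
  EVERY START: Crooks pair out of a finite non-zero `ν₀`, `ν₀`-invariant Markov level sampler `T`
  minorised by a non-zero finite `m`, measurable `φ ∈ L¹(π₀)`: from EVERY initial configuration the
  time average of `φ` along the chain "round trip after `T`" converges to `∫ φ dπ₀` almost surely.
* §3 **`CrooksPair.tendsto_sum_div_wilsonHeatBathTempered_everyStart`** — THE ENGINE INSTANCE: torus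
  Wilson theory, heat-bath link sweep between round trips, every continuous observable, EVERY
  initial gauge field.

NOT CLAIMED: rates beyond the Doeblin burn-in (the constant `m(Ω)` is the heat-bath one,
astronomically small); anything numerical.
-/

namespace Summit.Ventures.LatticeQCDFlow.Exactness.GeneralNCMC

open MeasureTheory ProbabilityTheory Set Filter Finset
open scoped ENNReal Topology

variable {Ω : Type*} [MeasurableSpace Ω]

/-! ## §1 An exact move after a minorised level sampler: every start -/

section Comp

variable (S T : Kernel Ω Ω) [IsMarkovKernel S] [IsMarkovKernel T] {π : Measure Ω}
  [IsProbabilityMeasure π]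

/-- The normalised push-forward `(m(Ω))⁻¹ (S ∘ₘ m)` of the minorising measure is a probability law. -/
theorem isProbabilityMeasure_normalised_bind {m : Measure Ω} [IsFiniteMeasure m] (hm0 : m univ ≠ 0) :
    IsProbabilityMeasure ((m univ)⁻¹ • m.bind S) :=
  ⟨by rw [Measure.smul_apply, smul_eq_mul, bind_apply_univ_of_markov S m,
    ENNReal.inv_mul_cancel hm0 (measure_ne_top _ _)]⟩

omit [IsMarkovKernel S] [IsMarkovKernel T] in
/-- **The one-step minorisation in skeleton form**: `m(Ω) • ((m(Ω))⁻¹ (S ∘ₘ m)) ≤ nHit (S ∘ₖ T) 1 z`. -/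
theorem smul_normalised_bind_le_nHit_one {m : Measure Ω} [IsFiniteMeasure m] (hm0 : m univ ≠ 0)
    (hmin : ∀ z, m ≤ T z) (z : Ω) :
    m univ • ((m univ)⁻¹ • m.bind S) ≤ nHit (S ∘ₖ T) 1 z := by
  rw [nHit_one, smul_smul, ENNReal.mul_inv_cancel hm0 (measure_ne_top _ _), one_smul]
  exact measure_le_comp T S hmin z

/-- **TIME AVERAGES CONVERGE FROM EVERY START for an exact move after a minorised level sampler.**
`π` invariant for `S ∘ₖ T`, `m ≤ T(z, ·)` for all `z` (`m` finite, non-zero): for every measurable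
`φ ∈ L¹(π)` and EVERY initial point `z`, `P_{δ_z}`-a.s. `(1/n) Σ_{i<n} φ(x_i) → ∫ φ dπ`. -/
theorem tendsto_sum_div_everyStart_chain_comp (hπ : Kernel.Invariant (S ∘ₖ T) π) {m : Measure Ω}
    [IsFiniteMeasure m] (hm0 : m univ ≠ 0) (hmin : ∀ z, m ≤ T z) {φ : Ω → ℝ} (hφm : Measurable φ)
    (hφ : Integrable φ π) (z : Ω) :
    ∀ᵐ x ∂(Kernel.trajMeasure (X := fun _ : ℕ => Ω) (Measure.dirac z)
        (fun n : ℕ => (S ∘ₖ T).comap (fun h : (j : ↥(Finset.Iic n)) → Ω =>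
          h ⟨n, Finset.mem_Iic.2 le_rfl⟩) (measurable_pi_apply _))),
      Tendsto (fun n : ℕ => (∑ i ∈ range n, φ (x i)) / n) atTop (𝓝 (∫ a, φ a ∂π)) := by
  haveI := isProbabilityMeasure_normalised_bind S hm0
  exact tendsto_sum_div_everyStart_of_nHit_minorised hπ hm0
    (smul_normalised_bind_le_nHit_one S T hm0 hmin) hφm hφ z

/-- **… and from every initial law.** -/
theorem tendsto_sum_div_anyLaw_chain_comp (hπ : Kernel.Invariant (S ∘ₖ T) π) {m : Measure Ω}
    [IsFiniteMeasure m] (hm0 : m univ ≠ 0) (hmin : ∀ z, m ≤ T z) {φ : Ω → ℝ} (hφm : Measurable φ)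
    (hφ : Integrable φ π) (μ₀ : Measure Ω) [IsProbabilityMeasure μ₀] :
    ∀ᵐ x ∂(Kernel.trajMeasure (X := fun _ : ℕ => Ω) μ₀
        (fun n : ℕ => (S ∘ₖ T).comap (fun h : (j : ↥(Finset.Iic n)) → Ω =>
          h ⟨n, Finset.mem_Iic.2 le_rfl⟩) (measurable_pi_apply _))),
      Tendsto (fun n : ℕ => (∑ i ∈ range n, φ (x i)) / n) atTop (𝓝 (∫ a, φ a ∂π)) := by
  haveI := isProbabilityMeasure_normalised_bind S hm0
  exact tendsto_sum_div_anyLaw_of_nHit_minorised hπ hm0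
    (smul_normalised_bind_le_nHit_one S T hm0 hmin) hφm hφ μ₀

/-- **Certified burn-in for an exact move after a minorised level sampler**: for every `[0,1]`-valued
measurable `g`, every initial law `μ₀` and every `n ≥ 1`,
`|E_{μ₀}[(1/n) Σ_{t<n} g(X_t)] − ∫ g dπ| ≤ 1/(m(Ω) n)`. -/
theorem chain_timeAverage_bias_le_chain_comp (hπ : Kernel.Invariant (S ∘ₖ T) π) {m : Measure Ω}
    [IsFiniteMeasure m] (hm0 : m univ ≠ 0) (hmin : ∀ z, m ≤ T z) (μ₀ : Measure Ω)
    [IsProbabilityMeasure μ₀] {g : Ω → ℝ} (hg : Measurable g) (h0 : ∀ y, 0 ≤ g y)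
    (h1 : ∀ y, g y ≤ 1) {n : ℕ} (hn : n ≠ 0) :
    |∫ x, (∑ t ∈ range n, g (x t)) / n ∂(Kernel.trajMeasure (X := fun _ : ℕ => Ω) μ₀
        (fun n : ℕ => (S ∘ₖ T).comap (fun h : (i : ↥(Finset.Iic n)) → Ω =>
          h ⟨n, Finset.mem_Iic.2 le_rfl⟩) (measurable_pi_apply _))) - ∫ x, g x ∂π| ≤
      1 / ((m univ).toReal * n) := by
  haveI := isProbabilityMeasure_normalised_bind S hm0
  obtain ⟨z⟩ := nonempty_of_isProbabilityMeasure π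
  haveI : Nonempty Ω := ⟨z⟩
  haveI := isMarkovKernel_nHit (S ∘ₖ T) 1
  have hD := smul_normalised_bind_le_nHit_one S T hm0 hmin
  have h := chain_timeAverage_bias_le_of_nHit (fun x B hB => minorised_setwise hD x hB)
    (pos_iff_ne_zero.2 hm0) (eps_le_one_of_minorised hD) one_pos hπ μ₀ hg h0 h1 hn
  simpa only [Nat.cast_one] using h

end Comp

/-! ## §2 Tempered transitions interleaved with a minorised level sampler: every start -/

namespace CrooksPair

variable [MeasurableSingletonClass Ω] {E : Type*} [MeasurableSpace E]
variable {ν₀ ν₁ : Measure Ω} [IsFiniteMeasure ν₀] [IsFiniteMeasure ν₁] {κF κR : Kernel Ω E}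
  [IsMarkovKernel κF] [IsMarkovKernel κR] {s e : E → Ω} {W : E → ℝ}

/-- **THE TEMPERED-TRANSITIONS LANE CONVERGES FROM EVERY INITIAL CONFIGURATION.**  For every Crooks
pair between finite weights (`Z₀ ≠ 0`), every `ν₀`-invariant Markov level sampler `T` minorised by a
non-zero finite measure, every measurable `φ ∈ L¹(π₀)` (`π₀ = Z₀⁻¹ ν₀`) and EVERY initial
configuration `x₀`: along the chain "round trip after `T`" started at `x₀`, the time average of `φ`
converges to `∫ φ dπ₀` almost surely. -/
theorem tendsto_sum_div_temperedChain_everyStart (h : CrooksPair ν₀ ν₁ κF κR s e W)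
    (h0 : ν₀ univ ≠ 0) (T : Kernel Ω Ω) [IsMarkovKernel T] (hT : Kernel.Invariant T ν₀)
    {m : Measure Ω} [IsFiniteMeasure m] (hm0 : m univ ≠ 0) (hmin : ∀ z, m ≤ T z) {φ : Ω → ℝ}
    (hφm : Measurable φ) (hφ : Integrable φ ((ν₀ univ)⁻¹ • ν₀)) (x₀ : Ω) :
    haveI := isMarkovKernel_ttKernel (κ := compFwd κF κR e h.measurable_e)
      (show Measurable (fun ε : E × E => W ε.1 + -W ε.2) from
        (h.measurable_W.comp measurable_fst).add (h.measurable_W.comp measurable_snd).neg)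
      (show Measurable (fun ε : E × E => s ε.2) from h.measurable_s.comp measurable_snd)
    ∀ᵐ x ∂(Kernel.trajMeasure (X := fun _ : ℕ => Ω) (Measure.dirac x₀)
        (fun n : ℕ => ((ttKernel (compFwd κF κR e h.measurable_e) (fun ε => W ε.1 + -W ε.2)
            fun ε => s ε.2) ∘ₖ T).comap
          (fun hh : (j : ↥(Finset.Iic n)) → Ω => hh ⟨n, Finset.mem_Iic.2 le_rfl⟩)
          (measurable_pi_apply _))),
      Tendsto (fun n : ℕ => (∑ i ∈ range n, φ (x i)) / n) atTop
        (𝓝 (∫ a, φ a ∂((ν₀ univ)⁻¹ • ν₀))) := by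
  haveI := isMarkovKernel_ttKernel (κ := compFwd κF κR e h.measurable_e)
    (show Measurable (fun ε : E × E => W ε.1 + -W ε.2) from
      (h.measurable_W.comp measurable_fst).add (h.measurable_W.comp measurable_snd).neg)
    (show Measurable (fun ε : E × E => s ε.2) from h.measurable_s.comp measurable_snd)
  haveI : IsProbabilityMeasure ((ν₀ univ)⁻¹ • ν₀) :=
    ⟨by rw [Measure.smul_apply, smul_eq_mul, ENNReal.inv_mul_cancel h0 (measure_ne_top _ _)]⟩
  have hinv : Kernel.Invariant ((ttKernel (compFwd κF κR e h.measurable_e)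
      (fun ε => W ε.1 + -W ε.2) fun ε => s ε.2) ∘ₖ T) ((ν₀ univ)⁻¹ • ν₀) :=
    invariant_smul _ ((temperedTransition_invariant h).comp hT) _
  exact tendsto_sum_div_everyStart_chain_comp _ T hinv hm0 hmin hφm hφ x₀

end CrooksPair

/-! ## §3 The engine instance: torus Wilson theory, heat-bath link sweep between round trips -/

section Wilson

open Literature.MathematicalPhysics.QuantumFieldTheory

variable {d L N : ℕ} {G : Type*} [Group G] [TopologicalSpace G] [IsTopologicalGroup G]
  (ρ : G →* Matrix (Fin N) (Fin N) ℂ) [CompactSpace G] [MeasurableSpace G] [BorelSpace G]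
  [SecondCountableTopology G] [MeasurableSingletonClass G]

/-- **THE TEMPERED-TRANSITIONS ENGINE INSTANCE FROM EVERY INITIAL GAUGE FIELD.**  Torus Wilson theory
(`G` compact second countable, `ρ` continuous, `L ≠ 0`), level sampler = the single-link heat-bath scan
over an edge list visiting every edge; for EVERY Crooks pair out of `wilsonWeight ρ β` driving the
round trips, every CONTINUOUS observable `φ` and EVERY initial configuration `U₀`: along the chain
started at `U₀` the time average of `φ` converges to `⟨φ⟩_β` almost surely. -/
theorem CrooksPair.tendsto_sum_div_wilsonHeatBathTempered_everyStart [NeZero L] (hρ : Continuous ρ)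
    (β : ℝ) {l : List (Edge d L)} (hl : ∀ ed, ed ∈ l) {E : Type*} [MeasurableSpace E]
    {ν₁ : Measure (GaugeConfig d L G)} [IsFiniteMeasure ν₁]
    {κF κR : Kernel (GaugeConfig d L G) E} [IsMarkovKernel κF] [IsMarkovKernel κR]
    {s e : E → GaugeConfig d L G} {W : E → ℝ}
    (h : CrooksPair (wilsonWeight (d := d) (L := L) ρ β) ν₁ κF κR s e W)
    {φ : GaugeConfig d L G → ℝ} (hφ : Continuous φ) :
    ∃ (_ : IsMarkovKernel (cycle (l.map (siteHeatBath (fun _ : Edge d L => haarProbability G)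
        (gibbsDensity fun U : GaugeConfig d L G => β * wilsonAction ρ U)))))
      (_ : IsMarkovKernel (ttKernel (compFwd κF κR e h.measurable_e) (fun ε => W ε.1 + -W ε.2)
        fun ε => s ε.2)),
      ∀ U₀ : GaugeConfig d L G, ∀ᵐ x ∂(Kernel.trajMeasure (X := fun _ : ℕ => GaugeConfig d L G)
          (Measure.dirac U₀)
          (fun n : ℕ => ((ttKernel (compFwd κF κR e h.measurable_e) (fun ε => W ε.1 + -W ε.2)
              fun ε => s ε.2) ∘ₖ
            cycle (l.map (siteHeatBath (fun _ : Edge d L => haarProbability G)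
              (gibbsDensity fun U : GaugeConfig d L G => β * wilsonAction ρ U)))).comap
            (fun hh : (j : ↥(Finset.Iic n)) → GaugeConfig d L G => hh ⟨n, Finset.mem_Iic.2 le_rfl⟩)
            (measurable_pi_apply _))),
        Tendsto (fun n : ℕ => (∑ i ∈ range n, φ (x i)) / n) atTop
          (𝓝 (∫ U, φ U ∂(((wilsonWeight (d := d) (L := L) ρ β) univ)⁻¹ •
            wilsonWeight (d := d) (L := L) ρ β))) := by
  obtain ⟨hMk, hfin, m, hmfin, h0, hm0, hK, hmin⟩ := wilson_heatBathSweep_package ρ hρ β hl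
  haveI := hMk
  haveI := hfin
  haveI := hmfin
  -- a continuous observable of the compact gauge field is bounded, hence integrable
  haveI : Nonempty (GaugeConfig d L G) := ⟨fun _ => 1⟩
  haveI hP : IsProbabilityMeasure (((wilsonWeight (d := d) (L := L) ρ β) univ)⁻¹ •
      wilsonWeight (d := d) (L := L) ρ β) :=
    ⟨by rw [Measure.smul_apply, smul_eq_mul, ENNReal.inv_mul_cancel h0 (measure_ne_top _ _)]⟩
  obtain ⟨ωb, -, hmax⟩ := isCompact_univ.exists_isMaxOn Set.univ_nonempty hφ.norm.continuousOn
  have hφi : Integrable φ (((wilsonWeight (d := d) (L := L) ρ β) univ)⁻¹ •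
      wilsonWeight (d := d) (L := L) ρ β) :=
    Integrable.of_bound hφ.measurable.aestronglyMeasurable ‖φ ωb‖
      (Eventually.of_forall fun U => (isMaxOn_iff.1 hmax) U (Set.mem_univ U))
  exact ⟨hMk, isMarkovKernel_ttKernel (κ := compFwd κF κR e h.measurable_e)
      (show Measurable (fun ε : E × E => W ε.1 + -W ε.2) from
        (h.measurable_W.comp measurable_fst).add (h.measurable_W.comp measurable_snd).neg)
      (show Measurable (fun ε : E × E => s ε.2) from h.measurable_s.comp measurable_snd),
    fun U₀ => h.tendsto_sum_div_temperedChain_everyStart h0 _ hK hm0 hmin hφ.measurable hφi U₀⟩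

end Wilson

end Summit.Ventures.LatticeQCDFlow.Exactness.GeneralNCMC
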